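import Literature.Barriers.AtomisticToContinuum.HalfFillingGaussianDomination
import HarnessLib

/-!
# Kennedy–Lieb–Shastry / Dyson–Lieb–Simon, XY model at positive temperature: Gaussian domination for every spin

Trunk T-QLATTICE; sibling proof file of `XYOrder.lean` (item
`provefact-Literature.MathematicalPhysics.QuantumLattice.kennedy_lieb_shastry_xy_thermal`). No
statement and no definition is introduced or changed. This file proves **Gaussian domination for
the Gibbs state of the ferromagnetic quantum XY model of arbitrary spin `S = n/2`**
([DLS1978] Thm. 4.2, real case; [LSSY2005] Ch. 11 (11.12) for `S = ½`): for the field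
Hamiltonian `H(h) = H - Σ_{⟨xy⟩}(h_x - h_y)(S¹_x - S¹_y) + ½Σ_{⟨xy⟩}(h_x - h_y)²`
(`xyFieldHamiltonian L n h`, `H = xyTorus d L n`) on the even torus `(ℤ/Lℤ)^d`, `L ≥ 4`, and every
`β > 0`, `Z_β(H(h)) ≤ Z_β(H)` (`partitionFn_xyField_le`). It is the all-spin, zero-staggered-field
version of `Literature.Barriers.AtomisticToContinuum.BoseGas.hc_partitionFn_field_le`
(`HalfFillingGaussianDomination.lean`, spin `½`), whose generic matrix lemmas it reuses, and the
positive-temperature counterpart of the ground-state Gaussian domination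
`kls_xy_gaussianDomination_ground_holds` (`XYOrderGDProofs.lean`), whose general-spin Kronecker
form and reflection geometry it reuses.

## The proof ([DLS1978] Lemma 4.1, Thm. 4.2; [KLS1988JSP] eqs. (15)–(21))

* `exists_unitary_conj_xyFieldHamiltonian`: the rotation by `π` about the `1`-axis on the odd
  sublattice of the bipartite even torus is a product unitary `W` with
  `W H(h) Wᴴ = H♭(h) = xyRealFieldHamiltonian L n h` for every field `h` (all bond terms real and
  ferromagnetic in the real matrices `T¹ = S¹`, `T² = iS²`; this is the unitary inside the proof
  of `groundEnergy_xyFieldHamiltonian_eq`, exposed for every spin).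
* `partitionFn_xyFieldHamiltonian_sq_le`: along every pair of planes `H♭(h)`, `H♭(h^L)`, `H♭(h^R)`
  are the Kronecker forms `A⊗1 + 1⊗B - ΣMᵢ⊗Nᵢ`, `A⊗1 + 1⊗A - ΣMᵢ⊗Mᵢ`, `B⊗1 + 1⊗B - ΣNᵢ⊗Nᵢ` with
  real `A, B, Mᵢ, Nᵢ` (`xyRealFieldHamiltonian_eq_submatrix`), so the Dyson–Lieb–Simon trace
  inequality `Matrix.trace_exp_kroneckerSum_le` ([DLS1978] Lemma 4.1) gives
  **`Z(h)² ≤ Z(h^L) Z(h^R)`**.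
* `partitionFn_xyField_le`: the descent of [DLS1978], proof of Thm. 4.2 — maximise `Z` over the
  finitely many fields with values in the range of `h`, then minimise the number of bonds with
  `h_x ≠ h_y`; a bad bond and the planes through it contradict `badBondCount_reflect`; no bad bond
  forces `H(h) = H`.

## References

* [DLS1978] F. J. Dyson, E. H. Lieb, B. Simon, *Phase transitions in quantum spin systems with
  isotropic and nonisotropic interactions*, J. Stat. Phys. 18 (1978) 335–383, Lemma 4.1,
  Theorem 4.2 (read in: E. H. Lieb, *Statistical Mechanics (Selecta)*, paper IV.3, pp. 163–166).
* [KLS1988JSP] T. Kennedy, E. H. Lieb, B. S. Shastry, J. Stat. Phys. 53 (1988) 1019–1030,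
  eqs. (15)–(21) (the rotation and the Kronecker form).
* [KLS1988PRL] T. Kennedy, E. H. Lieb, B. S. Shastry, Phys. Rev. Lett. 61 (1988) 2582–2584.
* [LSSY2005] E. H. Lieb, R. Seiringer, J. P. Solovej, J. Yngvason, *The Mathematics of the Bose
  Gas and its Condensation* (2005), Ch. 11, (11.12)–(11.20).
-/

noncomputable section

open Matrix Finset NormedSpace
open scoped ComplexOrder Kronecker
open Literature.MathematicalPhysics.QuantumLattice Literature.MathematicalPhysics.QuantumLattice.SpinOperators
  Literature.Probability.LatticeModels Literature.Barriers.AtomisticToContinuum.BoseGas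

namespace Literature.MathematicalPhysics.QuantumLattice

variable {d : ℕ}

/-! ### The sublattice rotation as a unitary, for every spin -/

section Rotation

variable (L : ℕ) [NeZero L]

/-- **The sublattice rotation** ([KLS1988JSP] eqs. (15)–(16); [DLS1978] §2): on the even torus of
side `L ≥ 3` and for every spin `n/2`, the rotation by `π` about the `1`-axis on the odd
sublattice is a unitary `W` with `W H(h) Wᴴ = H♭(h)` for every real field `h` on `S¹`
(`H(h) = xyFieldHamiltonian L n h`, `H♭(h) = xyRealFieldHamiltonian L n h`). This is the unitary
of the proof of `groundEnergy_xyFieldHamiltonian_eq`, exposed as an existence statement.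
[cite: KLS1988JSP, eqs. (15)–(17)] [cite: DysonLiebSimon1978, §2] -/
theorem exists_unitary_conj_xyFieldHamiltonian (hL : Even L) (hL3 : 3 ≤ L) (n : ℕ) :
    ∃ W ∈ Matrix.unitaryGroup (TensorIndex (TorusSite d L) (n + 1)) ℂ,
      ∀ h : TorusSite d L → ℝ,
        W * xyFieldHamiltonian L n h * Wᴴ = xyRealFieldHamiltonian L n h := by
  obtain ⟨k, rfl⟩ : ∃ k, L = 2 * k := ⟨L / 2, by obtain ⟨k, hk⟩ := hL; omega⟩
  set E := (torusGraph d (2 * k)).edgeFinset with hE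
  -- the single-site rotation `R₁ = D² V²` (`π` about the `1`-axis): `Sˣ ↦ Sˣ`, `Sʸ ↦ -Sʸ`
  obtain ⟨V, hV, hV', hVz, hVx, hVy⟩ := exists_unitary_conj_spinZ_eq_spinX n
  obtain ⟨D, hD, hD', hDx, hDy, hDz⟩ := exists_unitary_conj_spinX_eq_neg_spinY n
  set R₁ := D * D * (V * V) with hR₁
  have hR₁R₁ : R₁ * R₁ᴴ = 1 := by
    rw [hR₁]
    simp only [conjTranspose_mul, Matrix.mul_assoc]
    rw [← Matrix.mul_assoc V Vᴴ, hV, Matrix.one_mul, ← Matrix.mul_assoc V Vᴴ, hV, Matrix.one_mul,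
      ← Matrix.mul_assoc D Dᴴ, hD, Matrix.one_mul, hD]
  have hR₁R₁' : R₁ᴴ * R₁ = 1 := by
    rw [hR₁]
    simp only [conjTranspose_mul, Matrix.mul_assoc]
    rw [← Matrix.mul_assoc Dᴴ D, hD', Matrix.one_mul, ← Matrix.mul_assoc Dᴴ D, hD', Matrix.one_mul,
      ← Matrix.mul_assoc Vᴴ V, hV', Matrix.one_mul, hV']
  have hconj : ∀ (A B M : Matrix (Fin (n + 1)) (Fin (n + 1)) ℂ),
      A * B * M * (A * B)ᴴ = A * (B * M * Bᴴ) * Aᴴ := by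
    intro A B M
    rw [conjTranspose_mul]
    simp only [Matrix.mul_assoc]
  have hR₁x : R₁ * spinX n * R₁ᴴ = spinX n := by
    rw [hR₁, hconj, hconj V V, hVx, Matrix.mul_neg, Matrix.neg_mul, hVz, hconj D D, Matrix.mul_neg,
      Matrix.neg_mul, hDx, neg_neg, hDy]
  have hR₁y : R₁ * spinY n * R₁ᴴ = -spinY n := by
    rw [hR₁, hconj, hconj V V, hVy, hVy, hconj D D, hDy, hDx]
  -- the product unitary on the odd sublattice
  set ε : TorusSite d (2 * k) → ZMod 2 := fun x =>
    ∑ j, ZMod.castHom (dvd_mul_right 2 k) (ZMod 2) (x j) with hε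
  set u : TorusSite d (2 * k) → Matrix (Fin (n + 1)) (Fin (n + 1)) ℂ :=
    fun z => if ε z = 0 then 1 else R₁ with hu
  have hua : ∀ z, u z * (u z)ᴴ = 1 := by
    intro z; simp only [hu]; split_ifs
    · rw [conjTranspose_one, Matrix.mul_one]
    · exact hR₁R₁
  have hua' : ∀ z, (u z)ᴴ * u z = 1 := by
    intro z; simp only [hu]; split_ifs
    · rw [conjTranspose_one, Matrix.mul_one]
    · exact hR₁R₁'
  set sgn : TorusSite d (2 * k) → ℂ := fun z => if ε z = 0 then 1 else -1 with hsgn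
  have hux : ∀ z, u z * spinX n * (u z)ᴴ = spinX n := by
    intro z; simp only [hu]; split_ifs
    · rw [conjTranspose_one, Matrix.mul_one, Matrix.one_mul]
    · exact hR₁x
  have huy : ∀ z, u z * spinY n * (u z)ᴴ = sgn z • spinY n := by
    intro z; simp only [hu, hsgn]; split_ifs
    · rw [conjTranspose_one, Matrix.mul_one, Matrix.one_mul, one_smul]
    · rw [hR₁y, neg_one_smul]
  have hedge : ∀ e ∈ E, ∀ x y, e = s(x, y) → sgn x * sgn y = -1 := by
    intro e he x y hexy
    subst hexy
    rw [hE, SimpleGraph.mem_edgeFinset, SimpleGraph.mem_edgeSet, torusGraph_adj_iff] at he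
    have h01 : ∀ t : ZMod 2, t = 0 ∨ t = 1 := by decide
    have key : ∀ x' : TorusSite d (2 * k), ∀ i, sgn x' * sgn (x' + Pi.single i 1) = -1 := by
      intro x' i
      have hpar : ε (x' + Pi.single i 1) = ε x' + 1 := torusParity_add_single k x' i
      simp only [hsgn, hpar]
      rcases h01 (ε x') with h0 | h1
      · rw [if_pos h0, if_neg (by rw [h0]; decide), one_mul]
      · rw [if_neg (by rw [h1]; decide), if_pos (by rw [h1]; decide), mul_one]
    obtain ⟨-, ⟨i, rfl⟩ | ⟨i, rfl⟩⟩ := he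
    · exact key x i
    · rw [mul_comm]; exact key y i
  set W := productOp u with hW
  have hWx : ∀ x : TorusSite d (2 * k), W * siteSpin n x 0 * Wᴴ = siteSpin n x 0 := by
    intro x
    rw [hW, productOp_conj_siteSpin hua, spinVec_zero, hux]
    rfl
  have hb0 : ∀ x y : TorusSite d (2 * k), W * spinBond n 0 x y * Wᴴ = spinBond n 0 x y := by
    intro x y
    rw [hW, productOp_conj_spinBond hua hua', spinVec_zero, hux, hux, spinBond]
    rfl
  have hb1 : ∀ x y : TorusSite d (2 * k), sgn x * sgn y = -1 →
      W * spinBond n 1 x y * Wᴴ = -spinBond n 1 x y := by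
    intro x y hxy
    rw [hW, productOp_conj_spinBond hua hua', spinVec_one, huy, huy, onSite_smul', onSite_smul',
      smul_mul_smul_comm, smul_mul_smul_comm, mul_comm (sgn y) (sgn x), hxy, spinBond]
    simp only [neg_smul, one_smul]
    rw [← neg_add, smul_neg]
    rfl
  have hW1 : W * (1 : Op (TorusSite d (2 * k)) (n + 1)) * Wᴴ = 1 := by
    rw [Matrix.mul_one, hW, productOp_mul_conjTranspose hua]
  refine ⟨W, Matrix.mem_unitaryGroup_iff.2 (by rw [hW]; exact productOp_mul_conjTranspose hua),
    fun h => ?_⟩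
  -- conjugate the edge sum
  rw [xyFieldHamiltonian_eq_edgeSum (2 * k) hL3, xyRealFieldHamiltonian, ← hE, Finset.mul_sum,
    Finset.sum_mul]
  refine sum_congr rfl fun e he => ?_
  induction e using Sym2.ind with
  | h x y =>
    have hs := hedge _ he x y rfl
    simp only [Sym2.lift_mk, xyRealBond, Matrix.mul_add, Matrix.add_mul, Matrix.mul_sub,
      Matrix.sub_mul, Matrix.mul_neg, Matrix.neg_mul, Matrix.mul_smul, Matrix.smul_mul, hb0,
      hb1 x y hs, hW1, hWx]
    abel

/-- The field Hamiltonian has the partition function of its real form: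
`Z_β(H(h)) = Z_β(H♭(h))` on the even torus of side `L ≥ 3` (unitary invariance of the trace of
the exponential). [cite: DysonLiebSimon1978, §2 and Thm. 4.2] -/
theorem partitionFn_xyFieldHamiltonian_eq_real (hL : Even L) (hL3 : 3 ≤ L) (n : ℕ) (β : ℝ)
    (h : TorusSite d L → ℝ) :
    partitionFn β (xyFieldHamiltonian L n h) = partitionFn β (xyRealFieldHamiltonian L n h) := by
  obtain ⟨W, hWu, hW⟩ := exists_unitary_conj_xyFieldHamiltonian (d := d) L hL hL3 n
  have hWu' : W ∈ unitary (Matrix (TensorIndex (TorusSite d L) (n + 1))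
      (TensorIndex (TorusSite d L) (n + 1)) ℂ) := hWu
  rw [← hW h, ← star_eq_conjTranspose, partitionFn_unitary_conj hWu']

end Rotation

/-! ### The reflection inequality `Z(h)² ≤ Z(h^L) Z(h^R)` -/

section Reflection

variable (L : ℕ) [NeZero L] (j : Fin d) (a : ZMod L)

/-- **The reflection inequality for the partition function of the spin-`n/2` XY model**
([DLS1978] Lemma 4.1 applied as in the proof of Thm. 4.2; [LSSY2005] (11.19) for spin `½`): on
the even torus of side `L ≥ 4`, for every pair of planes, every `β > 0` and every real field `h`
on `S¹`, `Z(h)² ≤ Z(h^L) Z(h^R)` with `Z(f) = Tr exp(-βH(f))`. After the sublattice rotation the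
three Hamiltonians are the Kronecker forms `A⊗1 + 1⊗B - ΣMᵢ⊗Nᵢ`, `A⊗1 + 1⊗A - ΣMᵢ⊗Mᵢ`,
`B⊗1 + 1⊗B - ΣNᵢ⊗Nᵢ` with real `A, B, Mᵢ, Nᵢ` (`xyRealFieldHamiltonian_eq_submatrix`), and
`Matrix.trace_exp_kroneckerSum_le` applies.
[cite: DysonLiebSimon1978, Lemma 4.1, Thm. 4.2] [cite: LSSY2005, Ch. 11 (11.13)–(11.19)] -/
theorem partitionFn_xyFieldHamiltonian_sq_le (hL : Even L) (hL3 : 3 ≤ L) (n : ℕ) {β : ℝ}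
    (hβ : 0 < β) (h : TorusSite d L → ℝ) :
    (partitionFn β (xyFieldHamiltonian L n h)).re ^ 2 ≤
      (partitionFn β (xyFieldHamiltonian L n (reflectFieldLeft L j a h))).re *
        (partitionFn β (xyFieldHamiltonian L n (reflectFieldRight L j a h))).re := by
  -- positivity of the three partition functions
  have hZpos : ∀ f : TorusSite d L → ℝ, 0 < (partitionFn β (xyFieldHamiltonian L n f)).re :=
    fun f => (partitionFn_re_pos β (xyFieldHamiltonian_isHermitian L n f)).1
  have hx0 := hZpos h
  have hy0 := hZpos (reflectFieldLeft L j a h)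
  have hz0 := hZpos (reflectFieldRight L j a h)
  -- abbreviations
  set A := xyLeftHamiltonian L j a hL n h with hA
  set B := xyLeftHamiltonian L j a hL n (fun y => h (Torus.reflectBetweenSites j a y)) with hB
  set M := xyCrossOp L j a hL n h with hM
  set N := xyCrossOp L j a hL n (fun y => h (Torus.reflectBetweenSites j a y)) with hN
  set e := torusSplit (q := n + 1) L j a hL with he
  -- the three Kronecker forms, as in `groundEnergy_reflect_le`
  have hK : xyRealFieldHamiltonian L n h =
      (A ⊗ₖ 1 + 1 ⊗ₖ B - ∑ i, M i ⊗ₖ N i).submatrix e e :=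
    xyRealFieldHamiltonian_eq_submatrix L j a hL n h
  have hKL : xyRealFieldHamiltonian L n (reflectFieldLeft L j a h) =
      (A ⊗ₖ 1 + 1 ⊗ₖ A - ∑ i, M i ⊗ₖ M i).submatrix e e := by
    rw [xyRealFieldHamiltonian_eq_submatrix L j a hL n,
      xyLeftHamiltonian_congr L j a n hL (fun x hx => reflectFieldLeft_of_mem L j a h hx),
      xyLeftHamiltonian_congr L j a n hL
        (fun x hx => reflectFieldLeft_reflectBetweenSites_of_mem L j a hL h hx),
      xyCrossOp_congr L j a n hL (fun x hx => reflectFieldLeft_of_mem L j a h hx),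
      xyCrossOp_congr L j a n hL (fun x hx => reflectFieldLeft_reflectBetweenSites_of_mem L j a hL h hx)]
  have hKR : xyRealFieldHamiltonian L n (reflectFieldRight L j a h) =
      (B ⊗ₖ 1 + 1 ⊗ₖ B - ∑ i, N i ⊗ₖ N i).submatrix e e := by
    rw [xyRealFieldHamiltonian_eq_submatrix L j a hL n,
      xyLeftHamiltonian_congr L j a n hL (fun x hx => reflectFieldRight_of_mem L j a h hx),
      xyLeftHamiltonian_congr L j a n hL
        (h₁ := fun y => reflectFieldRight L j a h (Torus.reflectBetweenSites j a y))
        (fun x hx => reflectFieldRight_reflectBetweenSites_of_mem L j a hL h hx),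
      xyCrossOp_congr L j a n hL (fun x hx => reflectFieldRight_of_mem L j a h hx),
      xyCrossOp_congr L j a n hL (h₁ := fun y => reflectFieldRight L j a h (Torus.reflectBetweenSites j a y))
        (fun x hx => reflectFieldRight_reflectBetweenSites_of_mem L j a hL h hx)]
  -- partition functions as traces of exponentials of the DLS forms
  have hZ : ∀ (X Y : Op (torusLeftHalf L j a) (n + 1))
      (P Q : torusCrossSites L j a × Bool → Op (torusLeftHalf L j a) (n + 1)),
      partitionFn β ((X ⊗ₖ (1 : Op (torusLeftHalf L j a) (n + 1)) +
        (1 : Op (torusLeftHalf L j a) (n + 1)) ⊗ₖ Y - ∑ i, P i ⊗ₖ Q i).submatrix e e) =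
      (exp ((-(β : ℂ) • X) ⊗ₖ (1 : Op (torusLeftHalf L j a) (n + 1)) +
        (1 : Op (torusLeftHalf L j a) (n + 1)) ⊗ₖ (-(β : ℂ) • Y) +
        ∑ i, ((Real.sqrt β : ℂ) • P i) ⊗ₖ ((Real.sqrt β : ℂ) • Q i))).trace := by
    intro X Y P Q
    rw [partitionFn_submatrix_equiv, partitionFn, gibbsWeight, neg_smul_kroneckerForm hβ.le]
  -- reality
  have hnegβ : ∀ {X : Op (torusLeftHalf L j a) (n + 1)}, Xᵀ = Xᴴ →
      (-(β : ℂ) • X)ᵀ = (-(β : ℂ) • X)ᴴ := by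
    intro X hX
    have h := transpose_eq_conjTranspose_ofReal_smul hX (-β)
    rwa [Complex.ofReal_neg] at h
  have hAt : (-(β : ℂ) • A)ᵀ = (-(β : ℂ) • A)ᴴ :=
    hnegβ (xyLeftHamiltonian_transpose_eq L j a n hL h)
  have hBt : (-(β : ℂ) • B)ᵀ = (-(β : ℂ) • B)ᴴ :=
    hnegβ (xyLeftHamiltonian_transpose_eq L j a n hL _)
  have hMt : ∀ i, ((Real.sqrt β : ℂ) • M i)ᵀ = ((Real.sqrt β : ℂ) • M i)ᴴ := fun i =>
    transpose_eq_conjTranspose_ofReal_smul (xyCrossOp_transpose_eq L j a n hL h i) _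
  have hNt : ∀ i, ((Real.sqrt β : ℂ) • N i)ᵀ = ((Real.sqrt β : ℂ) • N i)ᴴ := fun i =>
    transpose_eq_conjTranspose_ofReal_smul (xyCrossOp_transpose_eq L j a n hL _ i) _
  haveI : Nonempty (torusLeftHalf L j a → Fin (n + 1)) := ⟨fun _ => 0⟩
  have hDLS := Matrix.trace_exp_kroneckerSum_le (m := torusLeftHalf L j a → Fin (n + 1))
    (n := torusLeftHalf L j a → Fin (n + 1)) hAt hBt hMt hNt
  -- the inequality `Z(h) ≤ Z(h^L)^{1/2} Z(h^R)^{1/2}`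
  have hineq : (partitionFn β (xyFieldHamiltonian L n h)).re ≤
      Real.sqrt (partitionFn β (xyFieldHamiltonian L n (reflectFieldLeft L j a h))).re *
      Real.sqrt (partitionFn β (xyFieldHamiltonian L n (reflectFieldRight L j a h))).re := by
    rw [partitionFn_xyFieldHamiltonian_eq_real L hL hL3,
      partitionFn_xyFieldHamiltonian_eq_real L hL hL3,
      partitionFn_xyFieldHamiltonian_eq_real L hL hL3, hK, hKL, hKR, hZ, hZ, hZ]
    exact hDLS
  calc _ ≤ (Real.sqrt (partitionFn β (xyFieldHamiltonian L n (reflectFieldLeft L j a h))).re *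
      Real.sqrt (partitionFn β (xyFieldHamiltonian L n (reflectFieldRight L j a h))).re) ^ 2 :=
        pow_le_pow_left₀ hx0.le hineq 2
    _ = _ := by rw [mul_pow, Real.sq_sqrt hy0.le, Real.sq_sqrt hz0.le]

end Reflection

/-! ### The descent: Gaussian domination at positive temperature -/

section Descent

variable (L : ℕ) [NeZero L]

/-- **Gaussian domination at positive temperature for the spin-`n/2` XY model**
([DLS1978] Thm. 4.2, XY case: `Z(h) ≤ Z(0)`; [LSSY2005] (11.12) for spin `½`): on the even torus
of side `L ≥ 4`, for every spin, every `β > 0` and every real field `h`,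
`Z_β(H - V_h + ½Q(h)) ≤ Z_β(H)`, `H = xyTorus d L n`, `V_h = Σ(h_x - h_y)(S¹_x - S¹_y)`,
`Q(h) = Σ(h_x - h_y)²`. Proof: the descent of [DLS1978], proof of Thm. 4.2 ([LSSY2005] after
(11.20); [KLS1988JSP] pp. 1027–1029): among the finitely many fields with values in the range
of `h` take a maximiser of `Z` with the fewest bonds `{x,y}` with `f_x ≠ f_y`; a bad bond and the
planes through it give `Z(f)² ≤ Z(f^L)Z(f^R)` (`partitionFn_xyFieldHamiltonian_sq_le`), so
`f^L`, `f^R` are maximisers and one has fewer bad bonds (`badBondCount_reflect`) — contradiction;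
so the maximiser is constant on bonds and its Hamiltonian is `H` itself.
[cite: DysonLiebSimon1978, Thm. 4.2] [cite: LSSY2005, Ch. 11 (11.12), (11.19)–(11.20)] -/
theorem partitionFn_xyField_le (hL : Even L) (h4 : 4 ≤ L) (n : ℕ) {β : ℝ} (hβ : 0 < β)
    (g : TorusSite d L → ℝ) :
    (partitionFn β (xyTorus d L n - xyGradField L n g +
        ((xyFieldEnergy L g / 2 : ℝ) : ℂ) • (1 : Op (TorusSite d L) (n + 1)))).re ≤
      (partitionFn β (xyTorus d L n)).re := by
  classical
  have hL3 : 3 ≤ L := by omega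
  have hL2 : 2 ≤ L := by omega
  rw [show xyTorus d L n - xyGradField L n g +
      ((xyFieldEnergy L g / 2 : ℝ) : ℂ) • (1 : Op (TorusSite d L) (n + 1)) =
      xyFieldHamiltonian L n g from rfl]
  -- the finite search space
  set V : Finset ℝ := (univ : Finset (TorusSite d L)).image g with hV
  set Zf : (TorusSite d L → V) → ℝ := fun f =>
    (partitionFn β (xyFieldHamiltonian L n (fun x => (f x : ℝ)))).re with hZf
  set Nf : (TorusSite d L → V) → ℕ := fun f => badBondCount L (fun x => (f x : ℝ)) with hNf
  set g' : TorusSite d L → V := fun x => ⟨g x, mem_image_of_mem g (mem_univ x)⟩ with hg'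
  haveI : Nonempty (TorusSite d L → V) := ⟨g'⟩
  obtain ⟨f₀, hf₀⟩ := Finite.exists_max Zf
  set S : Finset (TorusSite d L → V) := univ.filter fun f => Zf f = Zf f₀ with hS
  obtain ⟨f₁, hf₁S, hf₁min⟩ := S.exists_min_image Nf ⟨f₀, by simp [hS]⟩
  have hZf₁ : Zf f₁ = Zf f₀ := (mem_filter.1 hf₁S).2
  -- positivity of `Z`
  have hZpos : ∀ f : TorusSite d L → ℝ, 0 < (partitionFn β (xyFieldHamiltonian L n f)).re :=
    fun f => (partitionFn_re_pos β (xyFieldHamiltonian_isHermitian L n f)).1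
  -- the maximiser has no bad bonds
  have hN0 : Nf f₁ = 0 := by
    by_contra hN
    -- a bad pair `(x₀, i)`
    obtain ⟨x₀, i, hbad⟩ : ∃ (x₀ : TorusSite d L) (i : Fin d),
        (f₁ x₀ : ℝ) ≠ f₁ (x₀ + Pi.single i 1) := by
      obtain ⟨e, he⟩ := Finset.card_ne_zero.1 hN
      obtain ⟨heE, hbe⟩ := mem_filter.1 he
      revert heE hbe
      refine Sym2.ind (fun u v => ?_) e
      intro heE hbe
      rw [SimpleGraph.mem_edgeFinset, SimpleGraph.mem_edgeSet, torusGraph_adj_iff] at heE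
      rw [Sym2.map_mk, Sym2.mk_isDiag_iff] at hbe
      obtain ⟨-, ⟨i, rfl⟩ | ⟨i, rfl⟩⟩ := heE
      · exact ⟨u, i, hbe⟩
      · exact ⟨v, i, fun h' => hbe h'.symm⟩
    -- the planes through it
    set j := i
    obtain ⟨hxCS, hθx⟩ := add_single_mem_torusCrossSites L hL2 j x₀
    set a : ZMod L := x₀ j with ha
    -- the reflected fields, inside the search space
    set φ : TorusSite d L → ℝ := fun x => (f₁ x : ℝ) with hφ
    set fL : TorusSite d L → V := fun y =>
      if y ∈ torusLeftHalf L j a then f₁ y else f₁ (Torus.reflectBetweenSites j a y) with hfL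
    set fR : TorusSite d L → V := fun y =>
      if y ∈ torusLeftHalf L j a then f₁ (Torus.reflectBetweenSites j a y) else f₁ y with hfR
    have hfLφ : (fun x => (fL x : ℝ)) = reflectFieldLeft L j a φ := by
      funext y
      simp only [hfL, reflectFieldLeft, hφ]
      split_ifs <;> rfl
    have hfRφ : (fun x => (fR x : ℝ)) = reflectFieldRight L j a φ := by
      funext y
      simp only [hfR, reflectFieldRight, hφ]
      split_ifs <;> rfl
    -- `Z(f₁)² ≤ Z(f^L) Z(f^R)`, and all three are at most the maximum `Z(f₁)`
    have hRP := partitionFn_xyFieldHamiltonian_sq_le L j a hL hL3 n hβ φ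
    have hEL : Zf fL = (partitionFn β (xyFieldHamiltonian L n (reflectFieldLeft L j a φ))).re := by
      simp only [hZf, hfLφ]
    have hER : Zf fR = (partitionFn β (xyFieldHamiltonian L n (reflectFieldRight L j a φ))).re := by
      simp only [hZf, hfRφ]
    have hE1 : Zf f₁ = (partitionFn β (xyFieldHamiltonian L n φ)).re := by simp only [hZf, hφ]
    rw [← hEL, ← hER, ← hE1] at hRP
    have h1 := hf₀ fL
    have h2 := hf₀ fR
    have hL0 : 0 < Zf fL := by rw [hEL]; exact hZpos _
    have hR0 : 0 < Zf fR := by rw [hER]; exact hZpos _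
    -- both reflected fields are maximisers
    have hELm : Zf fL = Zf f₀ := by
      by_contra hne
      have hlt : Zf fL < Zf f₀ := lt_of_le_of_ne h1 hne
      have : Zf fL * Zf fR < Zf f₀ * Zf f₀ := mul_lt_mul hlt h2 hR0 (hlt.le.trans' hL0.le)
      rw [hZf₁] at hRP
      nlinarith
    have hERm : Zf fR = Zf f₀ := by
      by_contra hne
      have hlt : Zf fR < Zf f₀ := lt_of_le_of_ne h2 hne
      have : Zf fL * Zf fR < Zf f₀ * Zf f₀ := mul_lt_mul' h1 hlt hR0.le (hL0.trans_le h1)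
      rw [hZf₁] at hRP
      nlinarith
    have hNL : Nf f₁ ≤ Nf fL := hf₁min fL (by simp [hS, hELm])
    have hNR : Nf f₁ ≤ Nf fR := hf₁min fR (by simp [hS, hERm])
    -- counting: `N(f^L) + N(f^R) + 2N_C = 2N(f)` with `N_C ≥ 1`
    have hcount := badBondCount_reflect L j a hL φ
    have hNLφ : Nf fL = badBondCount L (reflectFieldLeft L j a φ) := by simp only [hNf, hfLφ]
    have hNRφ : Nf fR = badBondCount L (reflectFieldRight L j a φ) := by simp only [hNf, hfRφ]
    have hN1φ : Nf f₁ = badBondCount L φ := by simp only [hNf, hφ]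
    have hC : 1 ≤ ∑ x ∈ torusCrossSites L j a,
        (if (Sym2.map φ s(x, Torus.reflectBetweenSites j a x)).IsDiag then 0 else 1) := by
      have hone : (if (Sym2.map φ s(x₀ + Pi.single j 1,
          Torus.reflectBetweenSites j a (x₀ + Pi.single j 1))).IsDiag then 0 else 1) = 1 := by
        simp only [hθx, Sym2.map_mk, Sym2.mk_isDiag_iff]
        rw [if_neg]
        exact fun h' => hbad h'.symm
      calc 1 = (if (Sym2.map φ s(x₀ + Pi.single j 1,
          Torus.reflectBetweenSites j a (x₀ + Pi.single j 1))).IsDiag then 0 else 1) := hone.symm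
        _ ≤ _ := Finset.single_le_sum (f := fun x =>
          if (Sym2.map φ s(x, Torus.reflectBetweenSites j a x)).IsDiag then 0 else 1)
          (fun _ _ => Nat.zero_le _) hxCS
    rw [← hNLφ, ← hNRφ, ← hN1φ] at hcount
    omega
  -- hence `H(f₁) = H` and `Z(g) ≤ Z(f₁) = Z(H)`
  have hH : xyFieldHamiltonian L n (fun x => (f₁ x : ℝ)) = xyTorus d L n :=
    xyFieldHamiltonian_eq_of_badBondCount_eq_zero L hL2 n hN0
  have hEg : Zf g' = (partitionFn β (xyFieldHamiltonian L n g)).re := by simp only [hZf, hg']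
  have h1 : Zf f₁ = (partitionFn β (xyTorus d L n)).re := by simp only [hZf, hH]
  rw [← hEg, ← h1, hZf₁]
  exact hf₀ g'

end Descent

end Literature.MathematicalPhysics.QuantumLattice
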